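import Mathlib
import HarnessLib
import Summits.Parity.Statement
import Summits.Parity.GeneralizedHardyLittlewood.Theses.ConvexityCrossing
import Summits.Parity.GeneralizedHardyLittlewood.Theses.SiegelSpectrumSplit
import Summits.Parity.GeneralizedHardyLittlewood.Theorems.GhostBoundaryCarvingTwoOfThreeNecessity
import Summits.Parity.GeneralizedHardyLittlewood.Theorems.ShiftedPrimeFactorNecessity
import Literature.Barriers.Parity.HensleyRichards

/-!
# ConvexityCrossing — necessity, exactness, kill path and regime map on the BORN decls

Hand file for route `route-Parity-ConvexityCrossing` (rev 0, commit cf14d7dc; items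
`ConvexityFails` = stmt-Parity-32197, `ConvexityLift` = stmt-Parity-32198; shared record items
Q 25148 · FU 26852 · UU 26853 · UL 26864). It re-proves §1–§4 of the cell kernel
`HOME/decomp-parity-lens-5/g8/ConvexityCrossing.lean` (rc 0, 0 sorry) against the born route decls:

* `convexityFails_iff_not_secondHL` — the born text IS `¬ SecondHardyLittlewoodConjecture` (`Iff.rfl`);
* NECESSITY `FL ⟹ ConvexityFails` (through the tree certificate ρ*(20000) ≥ 2263 > 2262 = π(20000),
  `hensleyRichards_incompatibility` ∘ landed `GhostBoundaryCarving.weakDHL_of_fixedLower`), hence from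
  `GHL` and from `Parity`; EXACTNESS `FL ⟺ ConvexityFails ∧ ConvexityLift`; CONTRACTION; `node_iff`;
* KILL PATH `(A) ⟹ ¬FL, ¬GHL, ¬Parity`;
* the lens-5 regime map on Hardy–Littlewood's ρ-function with the cluster predicate INLINED
  (`∃ᶠ x in atTop, m ≤ π (x + y) - π x`, no new `def : Prop`), incl. the certified crossing at y = 20000.

0 sorry · standard axioms · no `set_option allowUnsafeReducibility`.
-/

namespace Summit.Parity.GeneralizedHardyLittlewood.Theses.ConvexityCrossing

open Filter Nat
open scoped Nat.Prime
open Summit.Parity.GeneralizedHardyLittlewood.Theses.SiegelSpectrumSplit (FixedLower)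
open Literature.Barriers.Parity (SecondHardyLittlewoodConjecture rhoStar HensleyRichards1974)
open Literature.NumberTheory.Sieve (WeakDicksonHardyLittlewood)

/-! ## §1 The credited piece, by name and in Σ-form -/

/-- The born text of `ConvexityFails` is literally `¬ (A)`. -/
theorem convexityFails_iff_not_secondHL : ConvexityFails ↔ ¬ SecondHardyLittlewoodConjecture :=
  Iff.rfl

/-- Σ-form: some window `(x, x+y]`, `x, y ≥ 2`, holds more primes than `(0, y]`.
[cite: Richards1974, §1.1 (A) and its equivalent form] -/
theorem convexityFails_iff :
    ConvexityFails ↔ ∃ x y : ℕ, 2 ≤ x ∧ 2 ≤ y ∧ π x + π y < π (x + y) := by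
  unfold ConvexityFails
  push Not
  rfl

/-- The born residual unfolds to `ConvexityFails → FL` (record leaf stmt-Parity-26863, by name). -/
theorem convexityLift_iff : ConvexityLift ↔ (ConvexityFails → FixedLower) := Iff.rfl

/-! ## §2 Leaf level and root form -/

/-- The two pieces give the record leaf `FL`. -/
theorem fixedLower_of_pieces (hC : ConvexityFails) (hL : ConvexityLift) : FixedLower := hL hC

/-- Root form (`Parity = BatemanHorn ∧ GeneralizedHardyLittlewood`) over the route's `closes`. -/
theorem closes_root (hBH : _root_.BatemanHorn) (hQ : BoundedSiegelZeroQuality) (hFU : FixedUpper)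
    (hUU : UniformUpperGivenFixed) (hC : ConvexityFails) (hL : ConvexityLift)
    (hUL : UniformLowerGivenFixed) : _root_.Parity :=
  ⟨hBH, closes hQ hFU hUU hC hL hUL⟩

/-! ## §3 Necessity, exactness, contraction, kill path -/

/-- NECESSITY at leaf level: `FL ⟹ ConvexityFails`, through the tree certificate
`ρ*(20000) ≥ 2263 > 2262 = π(20000)` inside `hensleyRichards_incompatibility`.
[cite: Richards1974, Corollary to Prop. 1.9] -/
theorem convexityFails_of_fixedLower (h : FixedLower) : ConvexityFails :=
  Literature.Barriers.Parity.hensleyRichards_incompatibility (GhostBoundaryCarving.weakDHL_of_fixedLower h)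

/-- The same necessity through the finite certificate ALONE (`DHL[2263, 2263]` suffices). -/
theorem convexityFails_of_weakDHL (h : WeakDicksonHardyLittlewood 2263 2263) : ConvexityFails :=
  Literature.Barriers.Parity.not_secondHardyLittlewood_of_weakDHL h

/-- NECESSITY from the conjunct `GHL` (landed `ShiftedPrimeFactor.fixedLower_of_ghl`). -/
theorem convexityFails_of_ghl (h : _root_.GeneralizedHardyLittlewood) : ConvexityFails :=
  convexityFails_of_fixedLower (ShiftedPrimeFactor.fixedLower_of_ghl h)

/-- NECESSITY from the summit. -/
theorem convexityFails_of_parity (h : _root_.Parity) : ConvexityFails := convexityFails_of_ghl h.2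

/-- The residual is implied by the leaf (trivially) — necessary. -/
theorem convexityLift_of_fixedLower (h : FixedLower) : ConvexityLift := fun _ => h

/-- Both pieces from the summit, hypothesis-free. -/
theorem pieces_of_parity (h : _root_.Parity) : ConvexityFails ∧ ConvexityLift :=
  ⟨convexityFails_of_parity h, convexityLift_of_fixedLower (ShiftedPrimeFactor.fixedLower_of_ghl h.2)⟩

/-- EXACTNESS at leaf level: `FL ⟺ ConvexityFails ∧ ConvexityLift`. -/
theorem fixedLower_iff : FixedLower ↔ ConvexityFails ∧ ConvexityLift :=
  ⟨fun h => ⟨convexityFails_of_fixedLower h, convexityLift_of_fixedLower h⟩, fun h => h.2 h.1⟩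

/-- CONTRACTION: once the credited piece is proved, the residual IS the leaf. -/
theorem contracts (hC : ConvexityFails) : ConvexityLift ↔ FixedLower :=
  ⟨fun hL => hL hC, fun h _ => h⟩

/-- Trivial branch: if the piece were refuted the residual holds vacuously. -/
theorem convexityLift_of_not (h : ¬ ConvexityFails) : ConvexityLift := fun hC => (h hC).elim

/-- `node_iff` at record level, modulo the record's own necessity `GHL → Q`. -/
theorem node_iff (hQ_of_ghl : _root_.GeneralizedHardyLittlewood → BoundedSiegelZeroQuality) :
    _root_.GeneralizedHardyLittlewood ↔
      (BoundedSiegelZeroQuality ∧ FixedUpper ∧ UniformUpperGivenFixed ∧ ConvexityFails ∧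
        ConvexityLift ∧ UniformLowerGivenFixed) :=
  ⟨fun h => ⟨hQ_of_ghl h, ShiftedPrimeFactor.fixedUpper_of_ghl h,
      ShiftedPrimeFactor.uniformUpperGivenFixed_of_ghl h, convexityFails_of_ghl h,
      convexityLift_of_fixedLower (ShiftedPrimeFactor.fixedLower_of_ghl h),
      ShiftedPrimeFactor.uniformLowerGivenFixed_of_ghl h⟩,
    fun h => closes h.1 h.2.1 h.2.2.1 h.2.2.2.1 h.2.2.2.2.1 h.2.2.2.2.2⟩

/-- KILL PATH: a proof of the convexity conjecture (A) refutes the leaf … -/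
theorem not_fixedLower_of_secondHL (hA : SecondHardyLittlewoodConjecture) : ¬ FixedLower :=
  fun h => convexityFails_of_fixedLower h hA

/-- … refutes the conjunct `GHL` … -/
theorem not_ghl_of_secondHL (hA : SecondHardyLittlewoodConjecture) :
    ¬ _root_.GeneralizedHardyLittlewood :=
  fun h => convexityFails_of_ghl h hA

/-- … and hence the summit. -/
theorem not_parity_of_secondHL (hA : SecondHardyLittlewoodConjecture) : ¬ _root_.Parity :=
  fun h => convexityFails_of_parity h hA

/-! ## §4 The lens-5 regime map on Hardy–Littlewood's ρ-function (cluster predicate inlined: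
«ρ(y) ≥ m» = `∃ᶠ x : ℕ in atTop, m ≤ π (x + y) - π x`) -/

/-- BRIDGE MONOTONICITY: longer windows / fewer primes are easier. [folklore] -/
theorem cluster_mono {y y' m m' : ℕ} (hy : y ≤ y') (hm : m' ≤ m)
    (h : ∃ᶠ x : ℕ in atTop, m ≤ π (x + y) - π x) :
    ∃ᶠ x : ℕ in atTop, m' ≤ π (x + y') - π x :=
  h.mono fun x hx => by
    have h1 : π (x + y) ≤ π (x + y') := Nat.monotone_primeCounting (by omega)
    have h2 : π x ≤ π (x + y) := Nat.monotone_primeCounting (by omega)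
    omega

/-- THE FINITE SIDE BOUNDS THE PRIME SIDE (Richards' Complement to (B), a THEOREM): `ρ(y) ≤ ρ*(y)`.
[cite: Richards1974, Complement to (B) and Prop. 1.9] -/
theorem le_rhoStar_of_cluster {y m : ℕ} (h : ∃ᶠ x : ℕ in atTop, m ≤ π (x + y) - π x) :
    m ≤ rhoStar y := by
  obtain ⟨x, hm, hx⟩ := (h.and_eventually (eventually_ge_atTop y)).exists
  exact hm.trans (Literature.Barriers.Parity.primeCounting_add_sub_le_rhoStar hx)

/-- FLOOR TRANSPORT: a gap `p_{n+1} ≤ p_n + H` infinitely often gives ρ(H+1) ≥ 2. [folklore] -/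
theorem cluster_two_of_gap {H : ℕ}
    (h : ∃ᶠ n : ℕ in atTop, Nat.nth Nat.Prime (n + 1) ≤ Nat.nth Nat.Prime n + H) :
    ∃ᶠ x : ℕ in atTop, 2 ≤ π (x + (H + 1)) - π x := by
  rw [Filter.frequently_atTop]
  intro a
  obtain ⟨n, hn, hgap⟩ := Filter.frequently_atTop.1 h a
  have hp := Nat.add_two_le_nth_prime n
  refine ⟨Nat.nth Nat.Prime n - 1, by omega, ?_⟩
  have h1 : π (Nat.nth Nat.Prime n - 1) = n := by
    rw [Nat.primeCounting_sub_one, Nat.primeCounting'_nth_eq]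
  have h2 : π (Nat.nth Nat.Prime (n + 1)) = n + 2 := by
    show Nat.count Nat.Prime (Nat.nth Nat.Prime (n + 1) + 1) = n + 2
    exact Nat.count_nth_succ_of_infinite Nat.infinite_setOf_prime (n + 1)
  have h3 : π (Nat.nth Nat.Prime (n + 1)) ≤ π (Nat.nth Nat.Prime n - 1 + (H + 1)) :=
    Nat.monotone_primeCounting (by omega)
  omega

/-- PRINTED FLOOR in the currency over the tree's Wave-0 fact (`p_{n+1} ≤ p_n + 246` i.o.): ρ(247) ≥ 2.
[cite: Polymath8b2014, Theorem 1.4(i)] -/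
theorem cluster_247_two_of_polymath
    (h : Literature.NumberTheory.Sieve.frequently_nth_prime_succ_le_add_polymath) :
    ∃ᶠ x : ℕ in atTop, 2 ≤ π (x + 247) - π x :=
  cluster_two_of_gap h

/-- THE CERTIFIED CROSSING (finite range, tree): at `y = 20000` the convexity line `m = π(y)+1 = 2263`
lies inside the admissible-packing region `m ≤ ρ*(y)`. [cite: Richards1974, Remark to Cor. 1.10] -/
theorem crossing_certified : π 20000 < 2263 ∧ 2263 ≤ rhoStar 20000 :=
  ⟨by rw [Literature.Barriers.Parity.primeCounting_twentyThousand]; decide,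
    Literature.Barriers.Parity.le_rhoStar_twentyThousand⟩

/-- BRIDGE (finite certificate → prime side): `DHL[2263, 2263]` gives ρ(20000) ≥ 2263 > π(20000).
[cite: Richards1974, Corollary to Prop. 1.9] -/
theorem cluster_twentyThousand_of_weakDHL (hB : WeakDicksonHardyLittlewood 2263 2263) :
    ∃ᶠ x : ℕ in atTop, 2263 ≤ π (x + 20000) - π x :=
  (Literature.Barriers.Parity.frequently_primeCounting_twentyThousand_lt hB).mono fun x hx => by
    rw [Literature.Barriers.Parity.primeCounting_twentyThousand] at hx
    omega

/-- … hence from the leaf (this is the BC3 stub `stub_clusterTwentyThousand` discharged under `FL`). -/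
theorem cluster_twentyThousand_of_fixedLower (h : FixedLower) :
    ∃ᶠ x : ℕ in atTop, 2263 ≤ π (x + 20000) - π x :=
  cluster_twentyThousand_of_weakDHL (GhostBoundaryCarving.weakDHL_of_fixedLower h 2263)

/-- A cluster beyond the convexity line at ANY length `y ≥ 2` is the credited piece. -/
theorem convexityFails_of_cluster {y m : ℕ} (h : ∃ᶠ x : ℕ in atTop, m ≤ π (x + y) - π x)
    (hπ : π y < m) (hy : 2 ≤ y) : ConvexityFails := by
  intro hA
  obtain ⟨x, hm, hx⟩ := (h.and_eventually (eventually_ge_atTop 2)).exists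
  have := hA x y hx hy
  omega

/-- The in-currency rung just ABOVE the piece (the BC3 stub `stub_failsOfCluster`, proved):
ρ(20000) ≥ 2263 gives the piece. -/
theorem convexityFails_of_cluster_twentyThousand
    (h : ∃ᶠ x : ℕ in atTop, 2263 ≤ π (x + 20000) - π x) : ConvexityFails :=
  convexityFails_of_cluster h
    (by rw [Literature.Barriers.Parity.primeCounting_twentyThousand]; decide) (by norm_num)

/-- The conjectured boundary is ATTAINED under the leaf: `FL ⟹ ρ(y) ≥ ρ*(y)` for every `y`.
[cite: Richards1974, Proposition 1.9] -/
theorem cluster_rhoStar_of_fixedLower (h : FixedLower) (y : ℕ) :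
    ∃ᶠ x : ℕ in atTop, rhoStar y ≤ π (x + y) - π x :=
  (Literature.Barriers.Parity.richards_prop_1_9 (GhostBoundaryCarving.weakDHL_of_fixedLower h (rhoStar y))).1.mono
    fun _ hx => hx.ge

/-- ASYMPTOTIC REGIME (named fact Hensley–Richards 1974, `ρ*(y) − π(y) → +∞`): under the leaf the prime
side crosses the convexity line at EVERY large length. [cite: HensleyRichards1974, §2; Richards1974,
Theorem 4.1 and Corollary 1.10] -/
theorem eventually_crossing_of_fixedLower (hHR : HensleyRichards1974) (h : FixedLower) :
    ∀ᶠ y : ℕ in atTop, ∃ᶠ x : ℕ in atTop, π y + 1 ≤ π (x + y) - π x :=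
  (hHR.corollary_1_10 (GhostBoundaryCarving.weakDHL_of_fixedLower h)).mono fun _ hy => hy.mono fun _ hx => by omega

end Summit.Parity.GeneralizedHardyLittlewood.Theses.ConvexityCrossing
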